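import Mathlib
import HarnessLib.Audit
import Summits.PneNP.PneNP.Theorems.PstarChordReadSwitch

/-!
# Switches with a SHARED partner: the twisted type-I kill (ROUND-24, O1 at exact tightness; memo g20 §13.3, residual R2)

FRONTIER range-avoidance ladder, rung F-N3, ROUND 24 (cell `pnp-ideate`, prover-2 memo `g20/O1-CHORD-READ-g20.md` §11 (residual R2: the partner `z`
of a private gate `(p, z)` is shared with a gate `(σ, z)`, `σ` a shared AND variable of the core) and §13.3; typed target
`PstarCoreBoundTargets.TerminalPeelable` (p646951); restricted-model proof complexity — nothing here bears on `P` versus `NP`).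

With a second gate `(σ, z)` on the switch `z`, flipping `z` moves `Γ₁` by `e ⊕ x_p ⊕ μ·x_σ`: on the slice `{x_q = 0}` the switch is live exactly at
`x_p = τ ⊕ μ x_σ` — a TWISTED slice.  In SEMANTIC form (the move hypothesis `hmove` says just this), for TYPE I (the switch invisible to `Γ₂`):

* `TwistedLocal I c σ C G` (def) — the reader is a function of `(x_a ⊕ x_b, x_p, x_q)` up to the linear term `ε·x_σ`;
* `twistedLocal_of_switch` — free lunch on the twisted slice + the slice lemma (applied to `C₂ ∖ p`, resp. `(C₂ ∖ p) △ {σ}`) make `Γ₂` twisted-local;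
* `eq_var_of_two_twistedLocal` — twisted-local at two distinct non-parallel chords (with `σⱼ ∉ vars cᵢ`, `σᵢ ∉ vars cᵢ`) forces `Γ₂ x = ε ∧ x_{σᵢ}`:
  the reader is `0` or the single shared variable `σᵢ`;
* `false_of_gval₂_eq_var` — `Γ₂ = x_σ` is impossible next to a live type-I switch (a solution with `x_q = 0`, `x_σ = b₂` exists by slice
  genericity; there both the point and its `z`-flip satisfy `Γ₂`, one satisfies `Γ₁`);
* `false_of_shared_typeI` — THE KILL: two distinct slice-generic chords, each with a `Γ₂`-invisible switch live on a twisted slice ⟹ dead.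
  (`μ = 0` is the plain type-I kill of `PstarChordReadSwitch`; the gate is taken on `p = vars c 2` — the `q`-side is the same proof with
  `PstarChordReadsMirror`.)

No Assumption A.  The derivation of the uniform type from RANK ONE in the shared menu needs `σ` to take both values on double slices — census
j317676 (memo §13.4) — and is not done here.
-/

set_option linter.dupNamespace false -- `Summit.PneNP.PneNP.…`: summit = sub-problem name (D-0017 single-conjunct layout)

open Finset Literature.Computability.Complexity
open scoped symmDiff
open Summit.PneNP.PneNP.Theorems.PstarFibrePolys (bit bit_injective bit_xor)
open Summit.PneNP.PneNP.Theorems.PstarTyped (Typed)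
open Summit.PneNP.PneNP.Theorems.PstarSALevel (varSet bdry BoundaryExpanding SimpleOverlap)
open Summit.PneNP.PneNP.Theorems.PstarGapPeeling (not_mem_varSet_of_private)
open Summit.PneNP.PneNP.Theorems.PstarCentreFree (vars_mem_varSet)
open Summit.PneNP.PneNP.Theorems.PstarGapOneAll (gval)
open Summit.PneNP.PneNP.Theorems.PstarGConstraint (bit_gval gval_false gval_update_of_forall_ne)
open Summit.PneNP.PneNP.Theorems.PstarChordRepair (IsChord)
open Summit.PneNP.PneNP.Theorems.PstarCoreBoundTargets (Terminal)
open Summit.PneNP.PneNP.Theorems.PstarGSystemFreeVar (gval_symmDiff)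
open Summit.PneNP.PneNP.Theorems.PstarFreshErase (slots_ne)
open Summit.PneNP.PneNP.Theorems.PstarChordReads (solves_update_of_chord)
open Summit.PneNP.PneNP.Theorems.PstarChordReadsMirror (solves_set_privates)
open Summit.PneNP.PneNP.Theorems.PstarChordReadLemma (ChordLocal SliceGeneric chordLocal_of_fail_slice)
open Summit.PneNP.PneNP.Theorems.PstarChordReadSwitch (gval₂_ne_of_switch₁ solves_update_of_outside false_of_gval₂_const)

namespace Summit.PneNP.PneNP.Theorems.PstarChordReadShared

variable {n m : ℕ}

/-! ## Small `gval` facts -/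

/-- The single read `{σ}` evaluates to `x_σ`. -/
theorem gval_singleton (I : LocalMap 4 n m) (σ : Fin n) (x : Fin n → Bool) : gval I {σ} ∅ x = x σ := by
  apply bit_injective
  rw [bit_gval, sum_singleton, sum_empty, add_zero]

/-- Splitting one linear variable off a reader: `gval C G = gval (C ∖ p) G ⊕ x_p` for `p ∈ C`. -/
theorem gval_erase_lin (I : LocalMap 4 n m) {C : Finset (Fin n)} {p : Fin n} (hp : p ∈ C) (G : Finset (Fin m)) (x : Fin n → Bool) :
    gval I C G x = xor (gval I (C.erase p) G x) (x p) := by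
  apply bit_injective
  rw [bit_xor, bit_gval, bit_gval, ← sum_erase_add _ _ hp]
  ring

/-- Adding the single read `σ`: `gval (C △ {σ}) G = gval C G ⊕ x_σ`. -/
theorem gval_symmDiff_singleton (I : LocalMap 4 n m) (C : Finset (Fin n)) (G : Finset (Fin m)) (σ : Fin n) (x : Fin n → Bool) :
    gval I (C ∆ {σ}) G x = xor (gval I C G x) (x σ) := by
  classical
  have h := gval_symmDiff I C {σ} G ∅ x
  rw [gval_singleton] at h
  rwa [show G ∆ (∅ : Finset (Fin m)) = G from by simp] at h

/-! ## Twisted-local readers -/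

/-- The reader `(C, G)` is **TWISTED-LOCAL** at the chord `c` with respect to `σ`: a function of `(x_a ⊕ x_b, x_p, x_q)` plus `ε·x_σ`. -/
def TwistedLocal (I : LocalMap 4 n m) (c : Fin m) (σ : Fin n) (C : Finset (Fin n)) (G : Finset (Fin m)) : Prop :=
  ∃ φ : Bool → Bool → Bool → Bool, ∃ ε : Bool, ∀ x : Fin n → Bool,
    gval I C G x = xor (φ (xor (x (I.vars c 0)) (x (I.vars c 1))) (x (I.vars c 2)) (x (I.vars c 3))) (ε && x σ)

section Main

variable {I : LocalMap 4 n m} {r : ℕ} {y : Fin m → Bool} {J₀ : Finset (Fin m)} {w₁ w₂ : Finset (Fin n) × Finset (Fin m) × Bool}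

/-- **Free lunch on a twisted slice makes `Γ₂` twisted-local.**  `z` outside the core and invisible to `Γ₂`; `Γ₂`'s monomials avoid the privates of
`c`; on the slice `{x_q = 0}` the switch `z` moves `Γ₁` whenever `x_p = τ ⊕ μ x_σ`; `c` slice-generic for the menu of `Γ₂`. -/
theorem twistedLocal_of_switch (hI : I.IsPure xorAndPred) (ht : Terminal I r y J₀ w₁ w₂) {c : Fin m} (hc : c ∈ J₀) (hch : IsChord I J₀ c)
    (hmono : ∀ g ∈ w₂.2.1, (I.vars g 2 ≠ I.vars c 2 ∧ I.vars g 3 ≠ I.vars c 2) ∧ (I.vars g 2 ≠ I.vars c 3 ∧ I.vars g 3 ≠ I.vars c 3))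
    (hgen : SliceGeneric I y J₀ c w₂.2.1) {z σ : Fin n} (hz : ∀ j ∈ J₀, z ∉ varSet I j) (hzC : z ∉ w₂.1)
    (hzG : ∀ g ∈ w₂.2.1, I.vars g 2 ≠ z ∧ I.vars g 3 ≠ z) (hσ : σ ∉ varSet I c) (τ μ : Bool)
    (hmove : ∀ x : Fin n → Bool, (∀ j ∈ J₀, I.eval x j = y j) → x (I.vars c 3) = false → x (I.vars c 2) = xor τ (μ && x σ) →
      gval I w₁.1 w₁.2.1 (Function.update x z (!x z)) ≠ gval I w₁.1 w₁.2.1 x) :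
    TwistedLocal I c σ w₂.1 w₂.2.1 := by
  classical
  have h23 : I.vars c 2 ≠ I.vars c 3 := fun h => absurd (hI.2 c h) (by decide)
  have hσp : σ ≠ I.vars c 2 := fun e => hσ (e ▸ vars_mem_varSet I c 2)
  have hmono₂ : ∀ g ∈ w₂.2.1, I.vars g 2 ≠ I.vars c 2 ∧ I.vars g 3 ≠ I.vars c 2 := fun g hg => (hmono g hg).1
  -- at a solution on the slice `x_q = 0`, re-set `p` to the live value: `Γ₂` fails there
  have key : ∀ x : Fin n → Bool, (∀ j ∈ J₀, I.eval x j = y j) → x (I.vars c 3) = false →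
      gval I w₂.1 w₂.2.1 (Function.update x (I.vars c 2) (xor τ (μ && x σ))) ≠ w₂.2.2 := by
    intro x hx hq
    have hx' := solves_update_of_chord hI hc hch hx hq (xor τ (μ && x σ))
    refine gval₂_ne_of_switch₁ ht hz hzC hzG hx' (hmove _ hx' ?_ ?_)
    · rw [Function.update_of_ne h23.symm]; exact hq
    · rw [Function.update_self, Function.update_of_ne hσp]
  by_cases hp : I.vars c 2 ∈ w₂.1
  · -- `p ∈ C₂`: the reader `(C₂ ∖ p) [△ {σ}]` misses a fixed target on the slice `(0,0)`
    cases μ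
    · have hloc : ChordLocal I c (w₂.1.erase (I.vars c 2)) w₂.2.1 := by
        refine chordLocal_of_fail_slice hI hc hch hgen hmono (Subset.refl _) false false (xor w₂.2.2 τ) fun x hx hp0 hq h => ?_
        refine key x hx hq ?_
        rw [gval_erase_lin I (by simpa using hp) w₂.2.1, Function.update_self,
          gval_update_of_forall_ne I x (notMem_erase _ _) hmono₂, h]
        cases w₂.2.2 <;> cases τ <;> cases x σ <;> decide
      obtain ⟨φ, hφ⟩ := hloc
      refine ⟨fun s u v => xor (φ s u v) u, false, fun x => ?_⟩
      rw [gval_erase_lin I hp, hφ x]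
      dsimp only
      rw [Bool.false_and, Bool.xor_false]
    · have hloc : ChordLocal I c ((w₂.1.erase (I.vars c 2)) ∆ {σ}) w₂.2.1 := by
        refine chordLocal_of_fail_slice hI hc hch hgen hmono (Subset.refl _) false false (xor w₂.2.2 τ) fun x hx hp0 hq h => ?_
        refine key x hx hq ?_
        rw [gval_erase_lin I (by simpa using hp) w₂.2.1, Function.update_self,
          gval_update_of_forall_ne I x (notMem_erase _ _) hmono₂]
        rw [gval_symmDiff_singleton] at h
        revert h
        cases gval I (w₂.1.erase (I.vars c 2)) w₂.2.1 x <;> cases w₂.2.2 <;> cases τ <;> cases x σ <;> decide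
      obtain ⟨φ, hφ⟩ := hloc
      refine ⟨fun s u v => xor (φ s u v) u, true, fun x => ?_⟩
      have h := hφ x
      rw [gval_symmDiff_singleton] at h
      rw [gval_erase_lin I hp]
      dsimp only
      revert h
      generalize φ (xor (x (I.vars c 0)) (x (I.vars c 1))) (x (I.vars c 2)) (x (I.vars c 3)) = f
      cases gval I (w₂.1.erase (I.vars c 2)) w₂.2.1 x <;> cases f <;> cases x (I.vars c 2) <;> cases x σ <;> decide
  · -- `p ∉ C₂`: `Γ₂` does not see `p`, so it fails on the whole slice `(0,0)`
    have hloc : ChordLocal I c w₂.1 w₂.2.1 := by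
      refine chordLocal_of_fail_slice hI hc hch hgen hmono (Subset.refl _) false false w₂.2.2 fun x hx hp0 hq h => ?_
      refine key x hx hq ?_
      rw [gval_update_of_forall_ne I x hp hmono₂, h]
    obtain ⟨φ, hφ⟩ := hloc
    exact ⟨φ, false, fun x => by rw [hφ x, Bool.false_and, Bool.xor_false]⟩

/-- **Twisted-local at two separated chords forces `Γ = ε·x_{σᵢ}`.**  Separation: the privates and some XOR variable of `cᵢ` are not variables
of `cⱼ` (distinct non-parallel chords), `σⱼ ∉ vars cᵢ`, `σᵢ ∉ vars cᵢ`. -/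
theorem eq_var_of_two_twistedLocal (hI : I.IsPure xorAndPred) {cᵢ cⱼ : Fin m} (hcᵢ : cᵢ ∈ J₀) (hcⱼ : cⱼ ∈ J₀) (hne : cᵢ ≠ cⱼ)
    (hchᵢ : IsChord I J₀ cᵢ) (hv : ∃ s : Fin 4, s.val < 2 ∧ I.vars cᵢ s ∉ varSet I cⱼ) {σᵢ σⱼ : Fin n} (hσᵢ : σᵢ ∉ varSet I cᵢ)
    (hσⱼ : σⱼ ∉ varSet I cᵢ) {C : Finset (Fin n)} {G : Finset (Fin m)} (hᵢ : TwistedLocal I cᵢ σᵢ C G) (hⱼ : TwistedLocal I cⱼ σⱼ C G) :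
    ∃ ε : Bool, ∀ x : Fin n → Bool, gval I C G x = (ε && x σᵢ) := by
  classical
  obtain ⟨φ, ε, hφ⟩ := hᵢ
  obtain ⟨ψ, ε', hψ⟩ := hⱼ
  obtain ⟨s, hs, hvs⟩ := hv
  have h01 : I.vars cᵢ 0 ≠ I.vars cᵢ 1 := fun h => absurd (hI.2 cᵢ h) (by decide)
  have h23 : I.vars cᵢ 2 ≠ I.vars cᵢ 3 := fun h => absurd (hI.2 cᵢ h) (by decide)
  obtain ⟨-, h0p, h0q, h1p, h1q⟩ := slots_ne hI (Or.inl ⟨rfl, rfl⟩ : (I.vars cᵢ 2 = I.vars cᵢ 2 ∧ I.vars cᵢ 3 = I.vars cᵢ 3) ∨ _)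
  have hpⱼ : I.vars cᵢ 2 ∉ varSet I cⱼ := not_mem_varSet_of_private I hcᵢ hcⱼ hne.symm hchᵢ.1 (vars_mem_varSet I cᵢ 2)
  have hqⱼ : I.vars cᵢ 3 ∉ varSet I cⱼ := not_mem_varSet_of_private I hcᵢ hcⱼ hne.symm hchᵢ.2 (vars_mem_varSet I cᵢ 3)
  have hs2 : I.vars cᵢ s ≠ I.vars cᵢ 2 := fun e => by have := hI.2 cᵢ e; subst this; simp at hs
  have hs3 : I.vars cᵢ s ≠ I.vars cᵢ 3 := fun e => by have := hI.2 cᵢ e; subst this; simp at hs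
  have hs01 : s = 0 ∨ s = 1 := by
    rcases Nat.lt_or_ge s.val 1 with h | h
    · exact Or.inl (Fin.ext (show s.val = 0 by omega))
    · exact Or.inr (Fin.ext (show s.val = 1 by omega))
  -- the indicator point of `U ⊆ {vars cᵢ s, p, q}` realising `(t, u, v)` is invisible to the `j`-form
  have ne_of_not_mem : ∀ {w : Fin n} {c : Fin m}, w ∉ varSet I c → ∀ k : Fin 4, w ≠ I.vars c k :=
    fun hw k e => hw (e ▸ vars_mem_varSet I _ k)
  have hφ0 : ∀ t u v : Bool, φ t u v = false := by
    intro t u v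
    let x : Fin n → Bool := fun w => (decide (w = I.vars cᵢ s) && t) || (decide (w = I.vars cᵢ 2) && u) || (decide (w = I.vars cᵢ 3) && v)
    -- the `j`-form vanishes at `x`
    have hxj : ∀ w, w ∈ varSet I cⱼ ∨ w = σⱼ → x w = false := by
      intro w hw
      have h1 : w ≠ I.vars cᵢ s := by
        rcases hw with hw | rfl
        · exact fun e => hvs (e ▸ hw)
        · exact ne_of_not_mem hσⱼ s
      have h2 : w ≠ I.vars cᵢ 2 := by
        rcases hw with hw | rfl
        · exact fun e => hpⱼ (e ▸ hw)
        · exact ne_of_not_mem hσⱼ 2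
      have h3 : w ≠ I.vars cᵢ 3 := by
        rcases hw with hw | rfl
        · exact fun e => hqⱼ (e ▸ hw)
        · exact ne_of_not_mem hσⱼ 3
      simp [x, h1, h2, h3]
    have hgx : gval I C G x = false := by
      rw [hψ x, hxj _ (Or.inl (vars_mem_varSet I cⱼ 0)), hxj _ (Or.inl (vars_mem_varSet I cⱼ 1)), hxj _ (Or.inl (vars_mem_varSet I cⱼ 2)),
        hxj _ (Or.inl (vars_mem_varSet I cⱼ 3)), hxj _ (Or.inr rfl)]
      have h0 := hψ (fun _ => false)
      rw [gval_false] at h0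
      simpa using h0.symm
    -- the `i`-form at `x` reads `φ t u v`
    have hσx : x σᵢ = false := by
      simp [x, ne_of_not_mem hσᵢ s, ne_of_not_mem hσᵢ 2, ne_of_not_mem hσᵢ 3]
    have hpx : x (I.vars cᵢ 2) = u := by simp [x, hs2.symm, h23]
    have hqx : x (I.vars cᵢ 3) = v := by simp [x, hs3.symm, h23.symm]
    have hsx : xor (x (I.vars cᵢ 0)) (x (I.vars cᵢ 1)) = t := by
      rcases hs01 with rfl | rfl
      · simp [x, h01.symm, h0p, h0q, h1p, h1q]
      · simp [x, h01, h0p, h0q, h1p, h1q]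
    have h := hφ x
    rw [hgx, hσx, hpx, hqx, hsx, Bool.and_false, Bool.xor_false] at h
    exact h.symm
  exact ⟨ε, fun x => by rw [hφ x, hφ0, Bool.false_xor]⟩

/-- **`Γ₂ = x_σ` is impossible next to a live type-I switch.**  With `c` slice-generic there is a solution with `x_q = 0`, `x_σ = b₂` and the live
value of `x_p`; it and its `z`-flip both satisfy `Γ₂`, and one of them satisfies `Γ₁`. -/
theorem false_of_gval₂_eq_var (hI : I.IsPure xorAndPred) (ht : Terminal I r y J₀ w₁ w₂) {c : Fin m} (hc : c ∈ J₀) (hch : IsChord I J₀ c)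
    {𝒢 : Finset (Fin m)} (hgen : SliceGeneric I y J₀ c 𝒢) {z σ : Fin n} (hz : ∀ j ∈ J₀, z ∉ varSet I j) (hzσ : z ≠ σ) (hσ : σ ∉ varSet I c)
    (τ μ : Bool)
    (hmove : ∀ x : Fin n → Bool, (∀ j ∈ J₀, I.eval x j = y j) → x (I.vars c 3) = false → x (I.vars c 2) = xor τ (μ && x σ) →
      gval I w₁.1 w₁.2.1 (Function.update x z (!x z)) ≠ gval I w₁.1 w₁.2.1 x)
    (h₂ : ∀ x : Fin n → Bool, gval I w₂.1 w₂.2.1 x = x σ) : False := by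
  classical
  have h23 : I.vars c 2 ≠ I.vars c 3 := fun h => absurd (hI.2 c h) (by decide)
  have hσp : σ ≠ I.vars c 2 := fun e => hσ (e ▸ vars_mem_varSet I c 2)
  have hσq : σ ≠ I.vars c 3 := fun e => hσ (e ▸ vars_mem_varSet I c 3)
  have hσ0 : σ ≠ I.vars c 0 := fun e => hσ (e ▸ vars_mem_varSet I c 0)
  have hσ1 : σ ≠ I.vars c 1 := fun e => hσ (e ▸ vars_mem_varSet I c 1)
  -- a solution of `J₀ ∖ c` on the slice `t = y_c` with `x_σ = b₂`
  obtain ⟨x₀, hx₀, hab, hxσ⟩ : ∃ x : Fin n → Bool, (∀ j ∈ J₀.erase c, I.eval x j = y j) ∧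
      xor (x (I.vars c 0)) (x (I.vars c 1)) = y c ∧ x σ = w₂.2.2 := by
    by_contra hno
    push Not at hno
    obtain ⟨φ, hφ⟩ := hgen {σ} ∅ (y c) w₂.2.2 (by simpa using hσp.symm) (by simpa using hσq.symm) (empty_subset _)
      (fun x hx hxab h => hno x hx hxab (by rw [← h, gval_singleton]))
    have h0 := hφ (fun _ => false)
    have h1 := hφ (Function.update (fun _ => false) σ true)
    rw [gval_singleton] at h0 h1
    rw [Function.update_self, Function.update_of_ne hσ0.symm, Function.update_of_ne hσ1.symm] at h1
    rw [← h0] at h1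
    exact Bool.noConfusion h1
  -- set the privates: `q := 0`, `p := τ ⊕ μ b₂`
  have hab' : xor (xor (x₀ (I.vars c 0)) (x₀ (I.vars c 1))) ((xor τ (μ && w₂.2.2)) && false) = y c := by
    rw [Bool.and_false, Bool.xor_false, hab]
  have hx := solves_set_privates hI hc hch hx₀ (xor τ (μ && w₂.2.2)) false hab'
  set x := Function.update (Function.update x₀ (I.vars c 2) (xor τ (μ && w₂.2.2))) (I.vars c 3) false with hxdef
  have hxq : x (I.vars c 3) = false := by rw [hxdef, Function.update_self]
  have hxσ' : x σ = w₂.2.2 := by rw [hxdef, Function.update_of_ne hσq, Function.update_of_ne hσp, hxσ]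
  have hxp : x (I.vars c 2) = xor τ (μ && x σ) := by rw [hxσ', hxdef, Function.update_of_ne h23, Function.update_self]
  have hm := hmove x hx hxq hxp
  have hx' := solves_update_of_outside hz hx (!x z)
  have h₂x : gval I w₂.1 w₂.2.1 x = w₂.2.2 := by rw [h₂, hxσ']
  have h₂x' : gval I w₂.1 w₂.2.1 (Function.update x z (!x z)) = w₂.2.2 := by rw [h₂, Function.update_of_ne hzσ.symm, hxσ']
  by_cases h₁ : gval I w₁.1 w₁.2.1 x = w₁.2.2
  · exact ht.2.2.2.2.2.2.1 ⟨x, hx, h₁, h₂x⟩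
  · refine ht.2.2.2.2.2.2.1 ⟨_, hx', ?_, h₂x'⟩
    revert h₁ hm; cases gval I w₁.1 w₁.2.1 (Function.update x z (!x z)) <;> cases gval I w₁.1 w₁.2.1 x <;> cases w₁.2.2 <;> decide

/-- **THE TWISTED TYPE-I KILL (residual R2, semantic form).**  Two distinct chords `cᵢ, cⱼ`, slice-generic for the menu of `Γ₂` (whose monomials
avoid their privates), each with an outside variable `zᵢ, zⱼ` invisible to `Γ₂` that moves `Γ₁` on the twisted slice `x_q = 0, x_p = τ ⊕ μ x_σ`
(`σᵢ, σⱼ` shared AND variables — any variables outside both chords): the terminal core is dead. -/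
theorem false_of_shared_typeI (hI : I.IsPure xorAndPred) (hT : Typed I) (hS : SimpleOverlap I) (hB : BoundaryExpanding r I)
    (ht : Terminal I r y J₀ w₁ w₂) {cᵢ cⱼ : Fin m} (hcᵢ : cᵢ ∈ J₀) (hcⱼ : cⱼ ∈ J₀) (hne : cᵢ ≠ cⱼ) (hchᵢ : IsChord I J₀ cᵢ)
    (hchⱼ : IsChord I J₀ cⱼ) (hv : ∃ s : Fin 4, s.val < 2 ∧ I.vars cᵢ s ∉ varSet I cⱼ)
    (hmonoᵢ : ∀ g ∈ w₂.2.1, (I.vars g 2 ≠ I.vars cᵢ 2 ∧ I.vars g 3 ≠ I.vars cᵢ 2) ∧ (I.vars g 2 ≠ I.vars cᵢ 3 ∧ I.vars g 3 ≠ I.vars cᵢ 3))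
    (hmonoⱼ : ∀ g ∈ w₂.2.1, (I.vars g 2 ≠ I.vars cⱼ 2 ∧ I.vars g 3 ≠ I.vars cⱼ 2) ∧ (I.vars g 2 ≠ I.vars cⱼ 3 ∧ I.vars g 3 ≠ I.vars cⱼ 3))
    (hgenᵢ : SliceGeneric I y J₀ cᵢ w₂.2.1) (hgenⱼ : SliceGeneric I y J₀ cⱼ w₂.2.1)
    {zᵢ zⱼ σᵢ σⱼ : Fin n} (hzᵢ : ∀ j ∈ J₀, zᵢ ∉ varSet I j) (hzᵢC : zᵢ ∉ w₂.1) (hzᵢG : ∀ g ∈ w₂.2.1, I.vars g 2 ≠ zᵢ ∧ I.vars g 3 ≠ zᵢ)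
    (hzⱼ : ∀ j ∈ J₀, zⱼ ∉ varSet I j) (hzⱼC : zⱼ ∉ w₂.1) (hzⱼG : ∀ g ∈ w₂.2.1, I.vars g 2 ≠ zⱼ ∧ I.vars g 3 ≠ zⱼ)
    (hzσ : zᵢ ≠ σᵢ) (hσᵢᵢ : σᵢ ∉ varSet I cᵢ) (hσⱼᵢ : σⱼ ∉ varSet I cᵢ) (hσⱼⱼ : σⱼ ∉ varSet I cⱼ)
    (τᵢ μᵢ τⱼ μⱼ : Bool)
    (hmoveᵢ : ∀ x : Fin n → Bool, (∀ j ∈ J₀, I.eval x j = y j) → x (I.vars cᵢ 3) = false → x (I.vars cᵢ 2) = xor τᵢ (μᵢ && x σᵢ) →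
      gval I w₁.1 w₁.2.1 (Function.update x zᵢ (!x zᵢ)) ≠ gval I w₁.1 w₁.2.1 x)
    (hmoveⱼ : ∀ x : Fin n → Bool, (∀ j ∈ J₀, I.eval x j = y j) → x (I.vars cⱼ 3) = false → x (I.vars cⱼ 2) = xor τⱼ (μⱼ && x σⱼ) →
      gval I w₁.1 w₁.2.1 (Function.update x zⱼ (!x zⱼ)) ≠ gval I w₁.1 w₁.2.1 x) : False := by
  have hᵢ := twistedLocal_of_switch hI ht hcᵢ hchᵢ hmonoᵢ hgenᵢ hzᵢ hzᵢC hzᵢG hσᵢᵢ τᵢ μᵢ hmoveᵢ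
  have hⱼ := twistedLocal_of_switch hI ht hcⱼ hchⱼ hmonoⱼ hgenⱼ hzⱼ hzⱼC hzⱼG hσⱼⱼ τⱼ μⱼ hmoveⱼ
  obtain ⟨ε, hε⟩ := eq_var_of_two_twistedLocal hI hcᵢ hcⱼ hne hchᵢ hv hσᵢᵢ hσⱼᵢ hᵢ hⱼ
  cases ε
  · exact false_of_gval₂_const hI hT hS hB ht fun x x' => by rw [hε, hε]; rfl
  · exact false_of_gval₂_eq_var hI ht hcᵢ hchᵢ hgenᵢ hzᵢ hzσ hσᵢᵢ τᵢ μᵢ hmoveᵢ fun x => by rw [hε]; rfl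

end Main

end Summit.PneNP.PneNP.Theorems.PstarChordReadShared
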